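import Summits.Ventures.Crystal3D.Bulk.HoleForm
import Summits.Ventures.Crystal3D.StickySpheres.ContactGraph
import HarnessLib

/-!
# K1 flux line: the Voronoi cell of a twelve-coordinated ball lies in a ball of radius `1/(2t)` (from `NoHole t`)

HONEST FRAMING. Venture `Summits/Ventures/Crystal3D` (cell `crystal3d-full`), route
`route-Ventures-StickyWulffConstant`, crux `NoReconstructionGain` (stmt-Ventures-19144), line
replication-exactness, K1 «Voronoi flux calibration» (memos `HOME/wulff-p1/g21/VFLUX-g21.md`,
`HOME/wulff-p1/g22/VFLUX2-g22.md`).  The flux identity `2(D − X) = Σ_i [(12 − deg_i) − 2√3 V_{i,z}]`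
assigns to a ball `i` the vector area `V_i` of the free (spherical) boundary of its Voronoi cell truncated
by the ball `B(x_i, r₀)`.  A twelve-coordinated ball has budget `12 − deg = 0`, so the per-ball calibration
is EXACT at degree twelve iff the truncated cell has no free boundary, i.e. iff the whole Voronoi cell of
the ball with respect to its twelve contact neighbours lies inside `B(x_i, r₀)`.  The cell is cut out by the
twelve bisector half-spaces `⟪p − x_i, w_k⟫ ≤ 1/2` (`w_k` the unit contact directions), and a cell point at
distance `ρ` from `x_i` in direction `u` forces `⟪u, w_k⟫ ≤ 1/(2ρ)` for every `k` — an empty spherical cap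
of cosine level `1/(2ρ)` in the contact shell.  Hence the tree's angular no-hole statement `NoHole t`
(`Bulk/HoleForm.lean`; CERTIFIED at `t = 0.625` as `CapX2.noHole_0625`, computational grade) bounds the
cell radius by `1/(2t)` — with `t = 0.625`: every twelve-coordinated ball's Voronoi cell lies in the OPEN
ball of radius `4/5` about its centre, so the calibration with truncation radius `r₀ ≥ 4/5` is exact at
degree twelve (memo VFLUX2-g22 §3: at `r₀ = 1/√2` it is NOT — a kissing dozen can leave a `46.55°` hole,
per-ball slack `−0.0068`).  This file proves the conditional (standard-axiom) statements; the companion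
`…DozenCellRadiusFourFifths.lean` discharges `t = 0.625` at computational grade.

* `norm_lt_of_noHole` — `NoHole t`, `0 < t`, twelve unit vectors with pairwise `⟪w_k, w_l⟫ ≤ 1/2`,
  `⟪p, w_k⟫ ≤ 1/2 ∀ k` ⟹ `‖p‖ < 1/(2t)`.
* `norm_lt_of_noHole_of_dist` — the same with the shell hypothesis as pairwise distance `≥ 1`.
* `dozenCell_dist_lt_of_noHole` — packing form: in a unit packing `x`, if ball `i` has twelve contacts
  `x (e k)` and `p` is at least as close to `x i` as to each of them, then `dist p (x i) < 1/(2t)`.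

WHAT THIS IS NOT: not a statement about areas or fluxes (the flux objects are not typed); no claim on the
crux; elementary inner-product algebra over the tree's `NoHole`.  F-C1 not moved.
-/

noncomputable section

open scoped InnerProductSpace RealInnerProductSpace

namespace Summit.Ventures.Crystal3D.Theorems

open Summit.Ventures.Crystal3D

/-- **Cell radius from the no-hole statement.**  If `NoHole t` holds with `0 < t`, then for twelve unit
vectors `w_k` with pairwise inner products `≤ 1/2` (a kissing dozen of contact directions) every point `p`
of the polyhedron `⟪p, w_k⟫ ≤ 1/2 (k = 1..12)` — the Voronoi cell of the central ball with respect to its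
twelve contact neighbours — satisfies `‖p‖ < 1/(2t)`: otherwise the direction of `p` would be an empty cap
of cosine level `t`. -/
theorem norm_lt_of_noHole {t : ℝ} (ht : NoHole t) (ht0 : 0 < t) {w : Fin 12 → EuclideanSpace ℝ (Fin 3)}
    (hw : ∀ k, ‖w k‖ = 1) (hww : ∀ k l, k ≠ l → ⟪w k, w l⟫_ℝ ≤ 1 / 2) {p : EuclideanSpace ℝ (Fin 3)}
    (hp : ∀ k, ⟪p, w k⟫_ℝ ≤ 1 / 2) : ‖p‖ < 1 / (2 * t) := by
  by_cases hp0 : p = 0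
  · subst hp0; rw [norm_zero]; positivity
  have hnp : 0 < ‖p‖ := norm_pos_iff.2 hp0
  set q : EuclideanSpace ℝ (Fin 3) := ‖p‖⁻¹ • p with hq
  have hq1 : ‖q‖ = 1 := by
    rw [hq, norm_smul, norm_inv, norm_norm, inv_mul_cancel₀ hnp.ne']
  obtain ⟨k, hk⟩ := ht w q hw hq1 hww
  have hqk : ⟪q, w k⟫_ℝ = ‖p‖⁻¹ * ⟪p, w k⟫_ℝ := by rw [hq, real_inner_smul_left]
  rw [hqk] at hk
  -- t < ‖p‖⁻¹ ⟪p, w_k⟫ ≤ ‖p‖⁻¹ / 2, hence ‖p‖ < 1/(2t)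
  have h1 : t * ‖p‖ < ⟪p, w k⟫_ℝ := by
    have h3 := mul_lt_mul_of_pos_left hk hnp
    rw [← mul_assoc, mul_inv_cancel₀ hnp.ne', one_mul] at h3
    linarith [h3]
  have h2 : t * ‖p‖ < 1 / 2 := lt_of_lt_of_le h1 (hp k)
  rw [lt_div_iff₀ (by positivity)]
  linarith

/-- The same with the kissing-dozen hypothesis written as pairwise DISTANCE `≥ 1` between the contact
directions (unit vectors `u, v` have `dist u v ≥ 1 ↔ ⟪u, v⟫ ≤ 1/2`). -/
theorem norm_lt_of_noHole_of_dist {t : ℝ} (ht : NoHole t) (ht0 : 0 < t) {w : Fin 12 → EuclideanSpace ℝ (Fin 3)}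
    (hw : ∀ k, ‖w k‖ = 1) (hww : ∀ k l, k ≠ l → (1 : ℝ) ≤ dist (w k) (w l)) {p : EuclideanSpace ℝ (Fin 3)}
    (hp : ∀ k, ⟪p, w k⟫_ℝ ≤ 1 / 2) : ‖p‖ < 1 / (2 * t) :=
  norm_lt_of_noHole ht ht0 hw
    (fun k l hkl => (one_le_dist_iff_inner_le_half (hw k) (hw l)).1 (hww k l hkl)) hp

/-- For a unit vector `w` (a contact neighbour at `x + w` of a ball at `x`), a point `p` is at least as close
to `x` as to `x + w` iff `⟪p − x, w⟫ ≤ 1/2` (the bisector half-space). -/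
theorem dist_le_dist_add_iff_inner_le_half (x p w : EuclideanSpace ℝ (Fin 3)) (hw : ‖w‖ = 1) :
    dist p x ≤ dist p (x + w) ↔ ⟪p - x, w⟫_ℝ ≤ 1 / 2 := by
  have h1 : dist p (x + w) ^ 2 = dist p x ^ 2 - 2 * ⟪p - x, w⟫_ℝ + 1 := by
    rw [dist_eq_norm, dist_eq_norm, show p - (x + w) = (p - x) - w by abel, norm_sub_sq_real, hw]
    ring
  constructor
  · intro h
    have h2 : dist p x ^ 2 ≤ dist p (x + w) ^ 2 := by
      exact pow_le_pow_left₀ dist_nonneg h 2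
    linarith [h1, h2]
  · intro h
    have h2 : dist p x ^ 2 ≤ dist p (x + w) ^ 2 := by linarith [h1]
    exact (pow_le_pow_iff_left₀ dist_nonneg dist_nonneg two_ne_zero).1 h2

/-- **Packing form (the K1 flux line's degree-twelve exactness radius).**  In a unit packing `x`, let the
ball `i` have twelve contact neighbours `x (e k)` (`dist = 1`, `e` injective).  Then every point
`p` of the Voronoi cell of `x i` relative to these twelve neighbours (`dist p (x i) ≤ dist p (x (e k))` for
all `k`) lies within distance `1/(2t)` of `x i`, provided `NoHole t` (`0 < t`).  With the tree's certified
`CapX2.noHole_0625` this radius is `4/5` (companion file): the cell — a fortiori the full Voronoi cell in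
the whole packing — is a bounded polyhedron inside the open ball `B(x i, 4/5)`, so a flux calibration
truncated at any `r₀ ≥ 4/5` sees no free boundary at a twelve-coordinated ball. -/
theorem dozenCell_dist_lt_of_noHole {t : ℝ} (ht : NoHole t) (ht0 : 0 < t) {N : ℕ} {x : Fin N → EuclideanSpace ℝ (Fin 3)}
    (hx : IsUnitPacking x) {i : Fin N} {e : Fin 12 → Fin N} (he : Function.Injective e)
    (hcontact : ∀ k, dist (x (e k)) (x i) = 1) {p : EuclideanSpace ℝ (Fin 3)}
    (hp : ∀ k, dist p (x i) ≤ dist p (x (e k))) : dist p (x i) < 1 / (2 * t) := by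
  set w : Fin 12 → EuclideanSpace ℝ (Fin 3) := fun k => x (e k) - x i with hw
  have hw1 : ∀ k, ‖w k‖ = 1 := fun k => by rw [hw, ← dist_eq_norm]; exact hcontact k
  have hww : ∀ k l, k ≠ l → (1 : ℝ) ≤ dist (w k) (w l) := by
    intro k l hkl
    have : dist (w k) (w l) = dist (x (e k)) (x (e l)) := by simp [hw, dist_eq_norm]
    rw [this]
    exact hx (fun h => hkl (he h))
  have hpk : ∀ k, ⟪p - x i, w k⟫_ℝ ≤ 1 / 2 := by
    intro k
    have h := hp k
    have hxe : x (e k) = x i + w k := by simp [hw]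
    rw [hxe] at h
    exact (dist_le_dist_add_iff_inner_le_half (x i) p (w k) (hw1 k)).1 h
  have := norm_lt_of_noHole_of_dist ht ht0 hw1 hww hpk
  rwa [← dist_eq_norm] at this

end Summit.Ventures.Crystal3D.Theorems

end
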